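import Summits.NavierStokesRegularity.OSWSelfSimilar.SheetRWeakProfilePV
import Literature.Analysis.Fourier.HilbertTransformLineDeriv
import Literature.Analysis.Fourier.HilbertTransformLineMoment
import Mathlib.MeasureTheory.Integral.IntegralEqImproper
import Mathlib.MeasureTheory.Integral.IntervalIntegral.IntegrationByParts
import HarnessLib

/-!
# SHEET-ℝ: the T-shift mode — `σ = 1` is an exact eigenvalue of the linearised profile map at a strong zero (pointwise identity)

HONEST FRAMING (cell ns-blowup GROUP B / zone Z3, case Z3-SR-SPEC, PREREG-SHEET-R-SPEC P4 (ii) item (P6); 1-D MODEL — the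
viscous gCLM / OSW sheet-ℝ profile equation; not Euler, not NS; «violates: none — MODEL»). Nothing here asserts that a
profile exists; the file is calculus about ANY sufficiently regular strong zero.

The profile map of the certificate (spelling of `SheetRStrongZeroBlowup`, `SheetRWeakToStrong`):

  `G(Ω)(X) = Ω(X) + ½X·Ω′(X) + a·𝒰Ω(X)·Ω′(X) − HΩ(X)·Ω(X) − ν·Ω″(X)`,  `𝒰Ω(X) = ∫₀^X HΩ`,
  `H = Literature.Analysis.Fourier.hilbertTransform`.

Its linearisation at `Ω` in the direction `v` is
  `DG(Ω)[v] = v + ½X·v′ + a·(𝒰v·Ω′ + 𝒰Ω·v′) − (Hv)·Ω − (HΩ)·v − ν·v″`,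
and the T-SHIFT (time-translation) MODE is the dilation generator `v := Ω + ½ξΩ′` (`= d/dμ|_{μ=1} μ·Ω(√μ ·)`).
Scaling the equation, `G(μΩ(√μ·)) = μ(μ−1)·(…)`-type bookkeeping gives the exact identity

  `DG(Ω)[v] + v = 2·G(Ω) + ½X·(G(Ω))′`                                                            (★)

(`Summit.NavierStokesRegularity.OSWSelfSimilar.SheetRTimeShiftMode.skeleton`, pure algebra on the point values, with the two
structural inputs `Hv = HΩ + ½X·(HΩ)′` and `𝒰v = ½𝒰Ω + ½X·HΩ` written out). Hence at a STRONG zero (`G(Ω) ≡ 0`):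
**`DG(Ω)[v](X) = −v(X)` at every `X`**, i.e. `σ = 1` is an eigenvalue of `−DG(Ω)` with eigenfunction the T-shift mode
(`Summit.NavierStokesRegularity.OSWSelfSimilar.SheetRTimeShiftMode.linearised_timeShiftMode_eq_zero`) — the first half of
(P6) of the spectral certificate «σ_p(−DG(Ω*)) ∩ {Re σ ≥ −0.03} = {1}» (what pins the ONE certified zero of the Evans
function to `σ = 1`). The analytic inputs are the tree's `Literature.Analysis.Fourier.hilbertTransform_mul_id` (moment
formula, `H[ξΩ′] = ξ·H[Ω′] − π⁻¹∫Ω′` with `∫Ω′ = 0`), `Literature.Analysis.Fourier.hasDerivAt_hilbertTransform`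
(`(HΩ)′ = H[Ω′]`) and `Literature.Analysis.Fourier.hilbertTransform_add`, valid in the DECAY CLASS
  `Ω ∈ C³`,  `Ω, ξΩ′ ∈ L¹`,  `|Ω″| ≤ M`,  `|Ω′(ξ)| ≤ C/(1+ξ²)`
(`Summit.NavierStokesRegularity.OSWSelfSimilar.SheetRTimeShiftMode.hilbertTransform_timeShiftMode`,
`Summit.NavierStokesRegularity.OSWSelfSimilar.SheetRTimeShiftMode.velocity_timeShiftMode`).

WHAT THIS IS NOT: not the second half of (P6) — that the mode `Ω* + ½ξΩ*′` lies in the certificate's energy space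
`E = odd H¹_{64+ξ²}` (i.e. `ξΩ*′, ξΩ*″ ∈ L²_{64+ξ²}`: a weighted-decay statement about the certified zero) is NOT proved
here; nor that the certified weak zero is `C³` with the decay above (the tree's bootstrap `SheetRWeakToStrong` gives `C²`
and the strong equation). MODEL statement; no NS content; no number of any certificate moves.
-/

noncomputable section

namespace Summit.NavierStokesRegularity.OSWSelfSimilar
namespace SheetRTimeShiftMode

open _root_.MeasureTheory _root_.Set _root_.Filter Literature.Analysis.Fourier intervalIntegral
open scoped Real Topology

/-! ### §1 The algebraic skeleton (explicit point values; no analysis) -/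

/-- **(★) at a point, with explicit values.** Write `Ω₀, Ω₁, Ω₂, Ω₃` for `Ω, Ω′, Ω″, Ω‴` at `X`, `h₀, h₁` for `HΩ, (HΩ)′`
at `X` and `U` for `𝒰Ω(X)`. If the profile equation holds at `X` (`hE`) together with its `X`-derivative (`hE'`, using
`𝒰Ω′ = HΩ`), then the linearisation applied to the T-shift mode — values `v = Ω₀ + ½XΩ₁`, `v′ = (3/2)Ω₁ + ½XΩ₂`,
`v″ = 2Ω₂ + ½XΩ₃`, `Hv = h₀ + ½Xh₁`, `𝒰v = ½U + ½Xh₀` — satisfies `DG(Ω)[v] + v = 0` (it equals `2·hE + ½X·hE'`).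
[folklore] -/
theorem skeleton {a ν X Ω₀ Ω₁ Ω₂ Ω₃ h₀ h₁ U : ℝ}
    (hE : Ω₀ + 1 / 2 * X * Ω₁ + a * U * Ω₁ - h₀ * Ω₀ - ν * Ω₂ = 0)
    (hE' : Ω₁ + (1 / 2 * Ω₁ + 1 / 2 * X * Ω₂) + a * (h₀ * Ω₁ + U * Ω₂) - (h₁ * Ω₀ + h₀ * Ω₁) - ν * Ω₃ = 0) :
    (Ω₀ + 1 / 2 * X * Ω₁) + 1 / 2 * X * (3 / 2 * Ω₁ + 1 / 2 * X * Ω₂)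
      + a * ((1 / 2 * U + 1 / 2 * X * h₀) * Ω₁ + U * (3 / 2 * Ω₁ + 1 / 2 * X * Ω₂))
      - (h₀ + 1 / 2 * X * h₁) * Ω₀ - h₀ * (Ω₀ + 1 / 2 * X * Ω₁) - ν * (2 * Ω₂ + 1 / 2 * X * Ω₃)
      + (Ω₀ + 1 / 2 * X * Ω₁) = 0 := by
  linear_combination 2 * hE + 1 / 2 * X * hE'

/-! ### §2 Calculus of the mode `v = Ω + ½ξΩ′` -/

section calculus

variable {Ω : ℝ → ℝ}

/-- `C³` bookkeeping: `Ω′ ∈ C²`, `Ω″ ∈ C¹`, and the three `HasDerivAt` facts. [folklore] -/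
private lemma contDiff_derivs (hΩ : ContDiff ℝ 3 Ω) :
    ContDiff ℝ 2 (deriv Ω) ∧ ContDiff ℝ 1 (deriv (deriv Ω)) ∧
      (∀ x, HasDerivAt Ω (deriv Ω x) x) ∧ (∀ x, HasDerivAt (deriv Ω) (deriv (deriv Ω) x) x) ∧
      (∀ x, HasDerivAt (deriv (deriv Ω)) (deriv (deriv (deriv Ω)) x) x) := by
  have h1 : ContDiff ℝ 2 (deriv Ω) := (contDiff_succ_iff_deriv.1 (hΩ : ContDiff ℝ (2 + 1) Ω)).2.2
  have h2 : ContDiff ℝ 1 (deriv (deriv Ω)) := (contDiff_succ_iff_deriv.1 (h1 : ContDiff ℝ (1 + 1) (deriv Ω))).2.2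
  refine ⟨h1, h2, fun x => ?_, fun x => ?_, fun x => ?_⟩
  · exact ((hΩ.differentiable (by norm_num)) x).hasDerivAt
  · exact ((h1.differentiable (by norm_num)) x).hasDerivAt
  · exact ((h2.differentiable (by norm_num)) x).hasDerivAt

/-- `iteratedDeriv 2 f = deriv (deriv f)`. [folklore] -/
private lemma iteratedDeriv_two_eq (f : ℝ → ℝ) : iteratedDeriv 2 f = deriv (deriv f) := by
  rw [show (2 : ℕ) = 1 + 1 from rfl, iteratedDeriv_succ, iteratedDeriv_one]

/-- First derivative of the T-shift mode: `v′ = (3/2)Ω′ + ½ξΩ″`. [folklore] -/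
theorem hasDerivAt_timeShiftMode (hΩ : ContDiff ℝ 3 Ω) (x : ℝ) :
    HasDerivAt (fun ξ => Ω ξ + 1 / 2 * ξ * deriv Ω ξ)
      (3 / 2 * deriv Ω x + 1 / 2 * x * deriv (deriv Ω) x) x := by
  obtain ⟨-, -, hd1, hd2, -⟩ := contDiff_derivs hΩ
  have hlin : HasDerivAt (fun ξ : ℝ => 1 / 2 * ξ) (1 / 2) x := by
    simpa using (hasDerivAt_id x).const_mul (1 / 2 : ℝ)
  have h := (hd1 x).add (hlin.mul (hd2 x))
  have hfun : (Ω + (fun ξ : ℝ => 1 / 2 * ξ) * deriv Ω) = fun ξ => Ω ξ + 1 / 2 * ξ * deriv Ω ξ := by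
    funext y; simp only [Pi.add_apply, Pi.mul_apply]
  rw [hfun] at h
  exact h.congr_deriv (by ring)

/-- `v′` as a function. [folklore] -/
theorem deriv_timeShiftMode (hΩ : ContDiff ℝ 3 Ω) :
    deriv (fun ξ => Ω ξ + 1 / 2 * ξ * deriv Ω ξ) =
      fun x => 3 / 2 * deriv Ω x + 1 / 2 * x * deriv (deriv Ω) x :=
  funext fun x => (hasDerivAt_timeShiftMode hΩ x).deriv

/-- Second derivative of the T-shift mode: `v″ = 2Ω″ + ½ξΩ‴`. [folklore] -/
theorem iteratedDeriv_two_timeShiftMode (hΩ : ContDiff ℝ 3 Ω) (x : ℝ) :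
    iteratedDeriv 2 (fun ξ => Ω ξ + 1 / 2 * ξ * deriv Ω ξ) x =
      2 * deriv (deriv Ω) x + 1 / 2 * x * deriv (deriv (deriv Ω)) x := by
  obtain ⟨-, -, -, hd2, hd3⟩ := contDiff_derivs hΩ
  rw [iteratedDeriv_two_eq, deriv_timeShiftMode hΩ]
  have hlin : HasDerivAt (fun ξ : ℝ => 1 / 2 * ξ) (1 / 2) x := by
    simpa using (hasDerivAt_id x).const_mul (1 / 2 : ℝ)
  have h := ((hd2 x).const_mul (3 / 2 : ℝ)).add (hlin.mul (hd3 x))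
  have hfun : ((fun y => 3 / 2 * deriv Ω y) + (fun ξ : ℝ => 1 / 2 * ξ) * deriv (deriv Ω)) =
      fun x => 3 / 2 * deriv Ω x + 1 / 2 * x * deriv (deriv Ω) x := by
    funext y; simp only [Pi.add_apply, Pi.mul_apply]
  rw [hfun] at h
  rw [h.deriv]
  ring

/-- Under `|Ω′(ξ)| ≤ C/(1+ξ²)` the derivative is integrable. [folklore] -/
private lemma integrable_deriv (hΩ : ContDiff ℝ 3 Ω) {C : ℝ} (hC : ∀ y, |deriv Ω y| ≤ C / (1 + y ^ 2)) :
    Integrable (deriv Ω) := by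
  obtain ⟨h1, -, -, -, -⟩ := contDiff_derivs hΩ
  refine Integrable.mono' ((integrable_inv_one_add_sq).const_mul C) h1.continuous.aestronglyMeasurable
    (Eventually.of_forall fun y => ?_)
  rw [Real.norm_eq_abs]
  simpa [div_eq_mul_inv] using hC y

/-- **`H` of the T-shift mode**: `H[Ω + ½ξΩ′](x) = HΩ(x) + ½x·(HΩ)′(x)` (and `(HΩ)′ = H[Ω′]`), for `Ω ∈ C³` with
`Ω, ξΩ′ ∈ L¹`, `|Ω″| ≤ M`, `|Ω′| ≤ C/(1+ξ²)` — moment formula with `∫Ω′ = 0` plus `(HΩ)′ = H[Ω′]`.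
[cite: King2009HilbertTransforms2, eq. (19.150) and Appendix 1 Table 1.1 (1.20)] -/
theorem hilbertTransform_timeShiftMode (hΩ : ContDiff ℝ 3 Ω) (hΩi : Integrable Ω)
    (hξ : Integrable fun y => y * deriv Ω y) {C : ℝ}
    (hC : ∀ y, |deriv Ω y| ≤ C / (1 + y ^ 2)) (x : ℝ) :
    hilbertTransform (fun ξ => Ω ξ + 1 / 2 * ξ * deriv Ω ξ) x =
      hilbertTransform Ω x + 1 / 2 * x * hilbertTransform (deriv Ω) x := by
  obtain ⟨h1, -, hd1, -, -⟩ := contDiff_derivs hΩ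
  have hΩ2 : ContDiff ℝ 2 Ω := hΩ.of_le (by norm_num)
  have hΩ1 : ContDiff ℝ 1 Ω := hΩ.of_le (by norm_num)
  have hd_int : Integrable (deriv Ω) := integrable_deriv hΩ hC
  -- `∫ Ω′ = 0`
  have hint0 : ∫ y, deriv Ω y = 0 := integral_eq_zero_of_hasDerivAt_of_integrable hd1 hd_int hΩi
  -- symmetric-integrand integrability for `Ω`, for `Ω′` and for `g = ½ξΩ′`
  have hsΩ := integrableOn_symmIntegrand_of_contDiff hΩ1 hΩi x
  have hsΩ' := integrableOn_symmIntegrand_of_contDiff (h1.of_le (by norm_num)) hd_int x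
  have hg1 : ContDiff ℝ 1 (fun y : ℝ => 1 / 2 * y * deriv Ω y) :=
    ((contDiff_const.mul contDiff_id).mul h1).of_le (by norm_num)
  have hgi : Integrable (fun y : ℝ => 1 / 2 * y * deriv Ω y) := by
    have := hξ.const_mul (1 / 2 : ℝ)
    refine this.congr (Eventually.of_forall fun y => ?_)
    show (1 : ℝ) / 2 * (y * deriv Ω y) = 1 / 2 * y * deriv Ω y
    ring
  have hsg := integrableOn_symmIntegrand_of_contDiff hg1 hgi x
  rw [hilbertTransform_add hsΩ hsg]
  have hmom := hilbertTransform_mul_id_of_integral_zero hd_int hsΩ' hint0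
  have hcm := hilbertTransform_const_mul (1 / 2 : ℝ) (fun y => y * deriv Ω y) x
  have hfun : (fun y : ℝ => 1 / 2 * (y * deriv Ω y)) = fun y => 1 / 2 * y * deriv Ω y := by
    funext y; ring
  rw [hfun] at hcm
  rw [hcm, hmom]
  ring

/-- `(HΩ)′ = H[Ω′]` and `HΩ ∈ C¹` in the decay class (tree lemma, restated as the bookkeeping used below).
[cite: King2009HilbertTransforms2, Appendix 1, Table 1.1, entry (1.20)] -/
theorem hasDerivAt_hilbertTransform_profile (hΩ : ContDiff ℝ 3 Ω) (hΩi : Integrable Ω) {M C : ℝ}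
    (hM : ∀ y, |deriv (deriv Ω) y| ≤ M) (hC : ∀ y, |deriv Ω y| ≤ C / (1 + y ^ 2)) (x : ℝ) :
    HasDerivAt (hilbertTransform Ω) (hilbertTransform (deriv Ω) x) x :=
  hasDerivAt_hilbertTransform (hΩ.of_le (by norm_num)) hΩi hM hC x

/-- `H[Ω′]` is continuous in the decay class (`Ω′ ∈ C¹ ∩ L¹`). [folklore] -/
private lemma continuous_hilbertTransform_deriv (hΩ : ContDiff ℝ 3 Ω) {C : ℝ}
    (hC : ∀ y, |deriv Ω y| ≤ C / (1 + y ^ 2)) : Continuous (hilbertTransform (deriv Ω)) := by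
  obtain ⟨h1, -, -, -, -⟩ := contDiff_derivs hΩ
  exact SheetRWeakProfilePV.continuous_hilbertTransform_of_contDiff (h1.of_le (by norm_num))
    (integrable_deriv hΩ hC)

/-- **Velocity of the T-shift mode**: `𝒰v(X) = ∫₀^X H[Ω + ½ξΩ′] = ½·𝒰Ω(X) + ½·X·HΩ(X)` (integration by parts of
`∫₀^X ½s·(HΩ)′(s) ds`). [folklore] -/
theorem velocity_timeShiftMode (hΩ : ContDiff ℝ 3 Ω) (hΩi : Integrable Ω)
    (hξ : Integrable fun y => y * deriv Ω y) {M C : ℝ} (hM : ∀ y, |deriv (deriv Ω) y| ≤ M)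
    (hC : ∀ y, |deriv Ω y| ≤ C / (1 + y ^ 2)) (X : ℝ) :
    ∫ s in (0 : ℝ)..X, hilbertTransform (fun ξ => Ω ξ + 1 / 2 * ξ * deriv Ω ξ) s =
      1 / 2 * (∫ s in (0 : ℝ)..X, hilbertTransform Ω s) + 1 / 2 * X * hilbertTransform Ω X := by
  have hH := hasDerivAt_hilbertTransform_profile hΩ hΩi hM hC
  have hcH : Continuous (hilbertTransform Ω) := continuous_iff_continuousAt.2 fun x => (hH x).continuousAt
  have hcH' : Continuous (hilbertTransform (deriv Ω)) := continuous_hilbertTransform_deriv hΩ hC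
  rw [intervalIntegral.integral_congr (fun s _ => hilbertTransform_timeShiftMode hΩ hΩi hξ hC s)]
  have hi1 : IntervalIntegrable (fun s => hilbertTransform Ω s) volume 0 X := hcH.intervalIntegrable _ _
  have hi2 : IntervalIntegrable (fun s => 1 / 2 * s * hilbertTransform (deriv Ω) s) volume 0 X :=
    ((continuous_const.mul continuous_id).mul hcH').intervalIntegrable _ _
  rw [intervalIntegral.integral_add hi1 hi2]
  -- integration by parts: `∫₀^X (½ s)·(HΩ)′(s) ds = ½X·HΩ(X) − ∫₀^X ½·HΩ`
  have hparts := intervalIntegral.integral_mul_deriv_eq_deriv_mul (a := 0) (b := X)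
    (u := fun s : ℝ => 1 / 2 * s) (u' := fun _ => (1 / 2 : ℝ))
    (v := hilbertTransform Ω) (v' := hilbertTransform (deriv Ω))
    (fun s _ => by simpa using (hasDerivAt_id s).const_mul (1 / 2 : ℝ)) (fun s _ => hH s)
    (continuous_const.intervalIntegrable _ _) (hcH'.intervalIntegrable _ _)
  rw [hparts, intervalIntegral.integral_const_mul]
  ring

end calculus

/-! ### §3 The T-shift identity at a strong zero -/

/-- **`σ = 1` is an exact eigenvalue of `−DG(Ω)` with eigenfunction the T-shift mode, pointwise.** Let `Ω ∈ C³` lie in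
the decay class `Ω, ξΩ′ ∈ L¹`, `|Ω″| ≤ M`, `|Ω′(ξ)| ≤ C/(1+ξ²)`, and let it be a STRONG zero of the sheet-ℝ profile
map, `Ω(X) + ½XΩ′(X) + a·(∫₀^X HΩ)·Ω′(X) − HΩ(X)·Ω(X) − ν·Ω″(X) = 0` for every `X`. Then the T-shift mode
`v = Ω + ½ξΩ′` satisfies, at every `X`,
`v(X) + ½X·v′(X) + a·(𝒰v(X)·Ω′(X) + 𝒰Ω(X)·v′(X)) − Hv(X)·Ω(X) − HΩ(X)·v(X) − ν·v″(X) + v(X) = 0`,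
i.e. `DG(Ω)[v] = −v` (`𝒰f(X) = ∫₀^X Hf`, `v″ = iteratedDeriv 2 v`). First half of PREREG-SHEET-R-SPEC P4 (ii) (P6);
MODEL statement, not NS. [folklore] -/
theorem linearised_timeShiftMode_eq_zero {a ν : ℝ} {Ω v : ℝ → ℝ} (hΩ : ContDiff ℝ 3 Ω) (hΩi : Integrable Ω)
    (hξ : Integrable fun y => y * deriv Ω y) {M C : ℝ} (hM : ∀ y, |deriv (deriv Ω) y| ≤ M)
    (hC : ∀ y, |deriv Ω y| ≤ C / (1 + y ^ 2))
    (hG : ∀ X, Ω X + 1 / 2 * X * deriv Ω X + a * (∫ s in (0 : ℝ)..X, hilbertTransform Ω s) * deriv Ω X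
      - hilbertTransform Ω X * Ω X - ν * iteratedDeriv 2 Ω X = 0)
    (hv : v = fun ξ => Ω ξ + 1 / 2 * ξ * deriv Ω ξ) (X : ℝ) :
    v X + 1 / 2 * X * deriv v X
      + a * ((∫ s in (0 : ℝ)..X, hilbertTransform v s) * deriv Ω X
        + (∫ s in (0 : ℝ)..X, hilbertTransform Ω s) * deriv v X)
      - hilbertTransform v X * Ω X - hilbertTransform Ω X * v X - ν * iteratedDeriv 2 v X + v X = 0 := by
  obtain ⟨-, -, hd1, hd2, hd3⟩ := contDiff_derivs hΩ
  subst hv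
  have hH := hasDerivAt_hilbertTransform_profile hΩ hΩi hM hC
  have hcH : Continuous (hilbertTransform Ω) := continuous_iff_continuousAt.2 fun x => (hH x).continuousAt
  -- `𝒰Ω′ = HΩ`
  have hUd : ∀ X, HasDerivAt (fun Y => ∫ s in (0 : ℝ)..Y, hilbertTransform Ω s) (hilbertTransform Ω X) X :=
    fun X => (hcH.integral_hasStrictDerivAt 0 X).hasDerivAt
  -- the profile equation with `Ω″ = deriv (deriv Ω)`, as an identically vanishing function
  have hG' : ∀ X, Ω X + 1 / 2 * X * deriv Ω X + a * (∫ s in (0 : ℝ)..X, hilbertTransform Ω s) * deriv Ω X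
      - hilbertTransform Ω X * Ω X - ν * deriv (deriv Ω) X = 0 := fun X => by
    have := hG X; rwa [iteratedDeriv_two_eq] at this
  -- its derivative at `X`
  have hlin : HasDerivAt (fun ξ : ℝ => 1 / 2 * ξ) (1 / 2) X := by
    simpa using (hasDerivAt_id X).const_mul (1 / 2 : ℝ)
  have h := ((((hd1 X).add (hlin.mul (hd2 X))).add (((hUd X).mul (hd2 X)).const_mul a)).sub
    ((hH X).mul (hd1 X))).sub ((hd3 X).const_mul ν)
  have hfun : (Ω + (fun ξ : ℝ => 1 / 2 * ξ) * deriv Ω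
        + (fun y => a * ((fun Y => ∫ s in (0 : ℝ)..Y, hilbertTransform Ω s) * deriv Ω) y)
        - hilbertTransform Ω * Ω - fun y => ν * deriv (deriv Ω) y) = fun _ => (0 : ℝ) := by
    funext Y
    simp only [Pi.add_apply, Pi.mul_apply, Pi.sub_apply]
    linear_combination hG' Y
  rw [hfun] at h
  have hE' := h.unique (hasDerivAt_const X (0 : ℝ))
  -- the four structural rewrites of the mode, then the algebraic skeleton
  rw [deriv_timeShiftMode hΩ, iteratedDeriv_two_timeShiftMode hΩ X,
    hilbertTransform_timeShiftMode hΩ hΩi hξ hC X, velocity_timeShiftMode hΩ hΩi hξ hM hC X]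
  have hsk := skeleton (Ω₃ := deriv (deriv (deriv Ω)) X) (h₁ := hilbertTransform (deriv Ω) X) (hG' X)
    (by linear_combination hE')
  linear_combination hsk

/-- **Eigen-form.** Under the hypotheses of `linearised_timeShiftMode_eq_zero`: `DG(Ω)[v](X) = −v(X)` at every `X`
(the same identity, solved for the linearisation). [folklore] -/
theorem linearised_timeShiftMode_eq_neg {a ν : ℝ} {Ω v : ℝ → ℝ} (hΩ : ContDiff ℝ 3 Ω) (hΩi : Integrable Ω)
    (hξ : Integrable fun y => y * deriv Ω y) {M C : ℝ} (hM : ∀ y, |deriv (deriv Ω) y| ≤ M)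
    (hC : ∀ y, |deriv Ω y| ≤ C / (1 + y ^ 2))
    (hG : ∀ X, Ω X + 1 / 2 * X * deriv Ω X + a * (∫ s in (0 : ℝ)..X, hilbertTransform Ω s) * deriv Ω X
      - hilbertTransform Ω X * Ω X - ν * iteratedDeriv 2 Ω X = 0)
    (hv : v = fun ξ => Ω ξ + 1 / 2 * ξ * deriv Ω ξ) (X : ℝ) :
    v X + 1 / 2 * X * deriv v X
      + a * ((∫ s in (0 : ℝ)..X, hilbertTransform v s) * deriv Ω X
        + (∫ s in (0 : ℝ)..X, hilbertTransform Ω s) * deriv v X)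
      - hilbertTransform v X * Ω X - hilbertTransform Ω X * v X - ν * iteratedDeriv 2 v X = -v X := by
  have h := linearised_timeShiftMode_eq_zero hΩ hΩi hξ hM hC hG hv X
  linarith

end SheetRTimeShiftMode
end Summit.NavierStokesRegularity.OSWSelfSimilar

end
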